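import Summits.QuantumFields.BalabanUV.Beta.GAN24.E3UnitSplit
import Summits.QuantumFields.BalabanUV.Beta.GAN24.PushSumNest

/-!
# `BalabanUV.Beta.GAN24.E3UnitSplitLevels` — binder row G-an2-4 / (CONV-C), S-slot, road «S3-fibre²»: THE (PC-1) UNIT SPLIT OF THE
# NORMALISED THIRD JET, part 2 — block supports of the pieces of `PushSumNest.Sc_succ_closed` and THE (Λ) / (V-H) TEMPLATES PER LEVEL
# with the residual power displayed as a function of (member, level) (row owner gan24-p1 RULINGS-2 «run the count per level m and report
# the residual power as a function of (n, m)»; engine of the idle leaf seat b2b-balaban-gan24-formalise-leaf-01-g10; part 1 =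
# `GAN24/E3UnitSplit` (functional, channels, Wilson split), part 3 = `GAN24/E3UnitSplitSum` (the member decomposition as ONE equation))

NOT IN PRINT; OUR PROOF ATTEMPT.  HONEST FRAMING (cell contract, verbatim): «discharging `BetaPertH` makes Bałaban's UV stability
UNCONDITIONAL — a real constructive-QFT result; it is NOT the continuum limit and NOT the Clay problem.»  HONEST DEPENDENCY (verbatim):
«continuum YM on T⁴ ⇐ BetaPertH ∧ nine spine estimates (0/9 proved); BetaPertH ⇐ (D1) ∧ (D4) ∧ CAP+tail; G-an2-4 gates asym, D1 and
NE2/3/4.»  [folklore] exponent bookkeeping over an2's DEFINITIONS and part 1's `e3OfS`; no estimate, no cited fact, no `def`, no `Prop`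
mirror; the only «analysis» is `tsum_mul_left`; NO tsum split or reordered.  Discharges NOTHING of «E3Shape»/«E3SupRate», (hS, hSall),
the K-slot, BetaPertH; NOT continuum, NOT Clay.

## What is proved (generic `d`; level `ℓ`, `M = Lc^ℓ`; an increment of level `ℓ` pushed `k` times sits in member `p = ℓ+k+1`, `N = Lc^p`)
§4 `pushSum_of_ff` (THE PUSH IS THE IDENTITY ON ff-SUPPORTED KERNELS: the Wilson table and every Lagrange increment enter all higher
   levels unchanged), `lagrInc_inl_inr`/`lagrInc_inr` (Λ increments are ff), `borderInc_*`/`vh0_*`/`pushSum_borderInc_*`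
   ((V-H) increments, pushed or not, are off-diagonal), `SLam0_*`.
§5 TEMPLATES (weights of `Sc_succ_closed` explicit; `wH`/`GamΦ` legs in the unit `N^{d+2}`, the multiplier–multiplier block of `KInv_N` in
   the (N3) unit `N^{2(d+1)}`, vertex-location sum as the block average `N^{−(d+1)}Σ'_u`; `hp : p = ℓ + k + 1` keeps the member exponent free):
   * Λ: `e3FF_unit_split_of` (any ff family), `e3Lam_unit_split`, `e3LamTop_unit_split` (`k = 0`), `e3Lam0_unit_split` (`ℓ = 0`):
     `N^{2(d+1)}·e3OfS N ((Lc^{d+1})^k·cΛ·M^{2d+4} • F) = −(cΛ/Lc^{d+1})·N^{d−2}·M^{d+3}·[unit sandwich of F]` (`e3Lam_residual`);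
   * (V-H): `e3VH_unit_split_of` (any off-diagonal family), `e3VH_unit_split`, `e3VHTop_unit_split` (`e3VH0_unit_split`, `ℓ = 0`, lives in part 3):
     `N^{2(d+1)}·e3OfS N ((Lc^{d+1})^k·cVH·M^{d+2} • P) = −(cVH/Lc^{d+1})·N^{−2}·M·[two-channel unit sandwich of P]` (`e3VH_residual`).
   THE COUNT (residual power vs the RAW (pushed) increment read by unit legs; part 1: Wilson `N^{d−3}` with one `N` on the table):
   Λ `N^{d−2}·M^{d+3}`, (V-H) `N^{−2}·M`.  READING (displayed, NOT claimed): R-S3-1b per channel ⇔ the unit sandwich of the level-`ℓ`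
   Λ increment is `O(N^{2−d}M^{−(d+3)}θ^k)` and of the pushed level-`ℓ` (V-H) increment `O(N^2M^{−1}θ^k)`, some `θ < 1` — the sizes
   D-S3-2 tests; whether an2's PROVISIONAL unit exponents make them true is R-S3-2 (the identities hold regardless).
-/

noncomputable section

open Finset
open scoped BigOperators
open Literature.MathematicalPhysics.QuantumFieldTheory
open Literature.MathematicalPhysics.QuantumFieldTheory.Balaban1983to89
open Literature.MathematicalPhysics.QuantumFieldTheory.Balaban1983to89.Beta
open ExpKernelCalculus (MKer comp)
open KernelSpecInstance (wH wΦ)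
open KKTFluctuationKernel (Gam GamΦ)
open OneStepResolventKernel (Fib LocStencil KInv wsum vertexOf KInv_inl_inr_coarse KInv_inr_inl_coarse KInv_inl_inl)
open StepJetData (wilsonA mfNeg)
open AveragingHessianKernels (vhS hessFF)
open InterLevelTransport (SLam avgLift cwsum cwsum_apply)
open BalabanStepJets (S0 lamCoeffOf)
open BalabanCompositeJets (Sc pushSum pushSum_inl_inl borderInc lagrInc)
open BalabanStepJetsSucc (e3Of mmRead)

namespace Summit.QuantumFields.BalabanUV.Beta.GAN24.E3UnitSplit

variable {d : ℕ}

/-! ## §4 Block supports of the composite pieces (which channel each increment of `Sc_succ_closed` feeds) -/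

section Blocks

variable {M L : ℕ}

/-- [folklore] A block that vanishes identically stays zero under the push. -/
theorem pushSum_block_zero (K : MKer (d + 1) (Fib d)) (a b : Fib d) (hK : ∀ x z, K x z a b = 0) (x w : Fin (d + 1) → ℤ) :
    pushSum M L K x w a b = 0 := by
  simp only [pushSum, hK, Finset.sum_const_zero, mul_zero]

/-- [folklore] **THE PUSH IS THE IDENTITY ON FIELD–FIELD-SUPPORTED KERNELS** (field legs are never pushed). -/
theorem pushSum_of_ff (K : MKer (d + 1) (Fib d)) (hfm : ∀ x z α ν, K x z (Sum.inl α) (Sum.inr ν) = 0)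
    (hmf : ∀ x z μ α, K x z (Sum.inr μ) (Sum.inl α) = 0) (hmm : ∀ x z μ ν, K x z (Sum.inr μ) (Sum.inr ν) = 0) :
    pushSum M L K = K := by
  funext x w a b
  rcases a with α | μ <;> rcases b with β | ν
  · exact pushSum_inl_inl M L K x w α β
  · rw [pushSum_block_zero K _ _ (fun x z => hfm x z α ν), hfm]
  · rw [pushSum_block_zero K _ _ (fun x z => hmf x z μ β), hmf]
  · rw [pushSum_block_zero K _ _ (fun x z => hmm x z μ ν), hmm]

/-- [folklore] A block that vanishes identically stays zero under the averaging lift. -/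
theorem avgLift_block_zero (G : MKer (d + 1) (Fib d)) (a b : Fib d) (hG : ∀ x z, G x z a b = 0) (x w : Fin (d + 1) → ℤ) :
    avgLift M G x w a b = 0 := by
  simp only [avgLift, hG, ite_self, mul_zero, Finset.sum_const_zero]

/-- [folklore] A block that vanishes identically for every curvature kernel stays zero in `S^Λ`. -/
theorem SLam_block_zero [NeZero M] (c : Fin (d + 1) → (Fin (d + 1) → ℤ) → Fin (d + 1) → (Fin (d + 1) → ℤ) → ℝ)
    (Q2 : Fin (d + 1) → (Fin (d + 1) → ℤ) → MKer (d + 1) (Fib d)) (a b : Fib d) (hQ : ∀ μ y x z, Q2 μ y x z a b = 0)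
    (κ : Fin (d + 1)) (u x z : Fin (d + 1) → ℤ) : SLam M c Q2 κ u x z a b = 0 := by
  simp only [SLam, cwsum_apply, hQ, mul_zero, tsum_zero, Finset.sum_const_zero, neg_zero]

/-- [folklore] **THE LAGRANGE INCREMENT IS FIELD–FIELD-SUPPORTED** (an1's constraint Hessian `hessFF` is): no (inl, inr) block. -/
theorem lagrInc_inl_inr {Lc M N' : ℕ} [NeZero N'] (κ : Fin (d + 1)) (u x z : Fin (d + 1) → ℤ) (α ν : Fin (d + 1)) :
    lagrInc d Lc M N' κ u x z (Sum.inl α) (Sum.inr ν) = 0 :=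
  SLam_block_zero _ _ _ _ (fun μ y x z => avgLift_block_zero _ _ _ (fun x z => AveragingHessianKernels.hessFF_inl_inr Lc μ y x z α ν) x z)
    κ u x z

/-- [folklore] The Lagrange increment has no multiplier rows. -/
theorem lagrInc_inr {Lc M N' : ℕ} [NeZero N'] (κ : Fin (d + 1)) (u x z : Fin (d + 1) → ℤ) (μ : Fin (d + 1)) (b : Fib d) :
    lagrInc d Lc M N' κ u x z (Sum.inr μ) b = 0 :=
  SLam_block_zero _ _ _ _ (fun μ' y x z => avgLift_block_zero _ _ _ (fun x z => AveragingHessianKernels.hessFF_inr Lc μ' y x z μ b) x z)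
    κ u x z

/-- [folklore] `S₀`'s Lagrange stencil has no (inl, inr) block. -/
theorem SLam0_inl_inr {Lc : ℕ} [NeZero Lc] (κ : Fin (d + 1)) (u x z : Fin (d + 1) → ℤ) (α ν : Fin (d + 1)) :
    SLam Lc (lamCoeffOf (KInv (N := Lc) (d := d)) Lc) (fun μ y => hessFF Lc μ y) κ u x z (Sum.inl α) (Sum.inr ν) = 0 :=
  SLam_block_zero _ _ _ _ (fun μ y x z => AveragingHessianKernels.hessFF_inl_inr Lc μ y x z α ν) κ u x z

/-- [folklore] `S₀`'s Lagrange stencil has no multiplier rows. -/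
theorem SLam0_inr {Lc : ℕ} [NeZero Lc] (κ : Fin (d + 1)) (u x z : Fin (d + 1) → ℤ) (μ : Fin (d + 1)) (b : Fib d) :
    SLam Lc (lamCoeffOf (KInv (N := Lc) (d := d)) Lc) (fun μ y => hessFF Lc μ y) κ u x z (Sum.inr μ) b = 0 :=
  SLam_block_zero _ _ _ _ (fun μ' y x z => AveragingHessianKernels.hessFF_inr Lc μ' y x z μ b) κ u x z

/-- [folklore] **THE BORDER INCREMENT IS OFF-DIAGONAL** (an1's `vhS` is a field–multiplier kernel): no field–field block … -/
theorem borderInc_inl_inl {Lc M : ℕ} (κ : Fin (d + 1)) (u x z : Fin (d + 1) → ℤ) (α β : Fin (d + 1)) :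
    borderInc d Lc M κ u x z (Sum.inl α) (Sum.inl β) = 0 := by
  simp only [borderInc]
  exact Finset.sum_eq_zero fun s _ => avgLift_block_zero _ _ _ (fun x z => by
    rw [StepJetData.mfNeg_inl_inl]; rfl) x z

/-- [folklore] … and no multiplier–multiplier block. -/
theorem borderInc_inr_inr {Lc M : ℕ} (κ : Fin (d + 1)) (u x z : Fin (d + 1) → ℤ) (μ ν : Fin (d + 1)) :
    borderInc d Lc M κ u x z (Sum.inr μ) (Sum.inr ν) = 0 := by
  simp only [borderInc]
  exact Finset.sum_eq_zero fun s _ => avgLift_block_zero _ _ _ (fun x z => by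
    rw [StepJetData.mfNeg_inr_inr]; rfl) x z

/-- [folklore] `S₀`'s (V-H) stencil has no field–field block … -/
theorem vh0_inl_inl {Lc : ℕ} (κ : Fin (d + 1)) (u x z : Fin (d + 1) → ℤ) (α β : Fin (d + 1)) :
    mfNeg (vhS d Lc κ u) x z (Sum.inl α) (Sum.inl β) = 0 := by
  rw [StepJetData.mfNeg_inl_inl]; rfl

/-- [folklore] … and no multiplier–multiplier block. -/
theorem vh0_inr_inr {Lc : ℕ} (κ : Fin (d + 1)) (u x z : Fin (d + 1) → ℤ) (μ ν : Fin (d + 1)) :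
    mfNeg (vhS d Lc κ u) x z (Sum.inr μ) (Sum.inr ν) = 0 := by
  rw [StepJetData.mfNeg_inr_inr]; rfl

end Blocks

/-! ## §5 The (Λ) ∕ (V-H) TEMPLATES per level -/

section Levels

variable {Lc : ℕ} [NeZero Lc]

/-- [folklore] **EXPONENT IDENTITY, Λ CHANNEL, LEVEL `ℓ`**: `N^{2(d+1)}·(Lc^{d+1})^k·cΛ·M^{2d+4} = (cΛ/Lc^{d+1})·N^{d−2}·M^{d+3}·[N^{d+2}·N^{−(d+1)}·N^{d+2}·N^{d+2}]`. -/
theorem e3Lam_residual (cΛ : ℝ) (ℓ k : ℕ) :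
    ((Lc : ℝ) ^ (ℓ + k + 1)) ^ (2 * (d + 1)) * (((Lc : ℝ) ^ (d + 1)) ^ k * (cΛ * ((Lc : ℝ) ^ ℓ) ^ (2 * d + 4))) =
      cΛ / (Lc : ℝ) ^ (d + 1) * ((Lc : ℝ) ^ (ℓ + k + 1)) ^ ((d : ℤ) - 2) * ((Lc : ℝ) ^ ℓ) ^ (d + 3) *
        (((Lc : ℝ) ^ (ℓ + k + 1)) ^ (d + 2) * (((Lc : ℝ) ^ (ℓ + k + 1)) ^ (d + 1))⁻¹ * ((Lc : ℝ) ^ (ℓ + k + 1)) ^ (d + 2) *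
          1 * ((Lc : ℝ) ^ (ℓ + k + 1)) ^ (d + 2)) := by
  have hL : (Lc : ℝ) ≠ 0 := by exact_mod_cast NeZero.ne Lc
  have hN : ((Lc : ℝ) ^ (ℓ + k + 1)) ≠ 0 := pow_ne_zero _ hL
  have hz : ((Lc : ℝ) ^ (ℓ + k + 1)) ^ ((d : ℤ) - 2) = ((Lc : ℝ) ^ (ℓ + k + 1)) ^ d / ((Lc : ℝ) ^ (ℓ + k + 1)) ^ 2 := by
    rw [zpow_sub₀ hN, zpow_natCast, zpow_ofNat]
  rw [hz]
  field_simp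
  ring

/-- [folklore] **`e3FF_unit_split_of` — THE (Λ) TEMPLATE** for ANY ff-supported family `F` with the level-`ℓ` Lagrange weight pushed `k` times
(member `p = ℓ+k+1`, `N = Lc^p`, `M = Lc^ℓ`): `N^{2(d+1)}·e3OfS N ((Lc^{d+1})^k·cΛ·M^{2d+4} • F) = −(cΛ/Lc^{d+1})·N^{d−2}·M^{d+3}·[unit sandwich of F]`
— residual `N^{d−2}·M^{d+3}` DISPLAYED, not claimed small. -/
theorem e3FF_unit_split_of (F : Fin (d + 1) → (Fin (d + 1) → ℤ) → MKer (d + 1) (Fib d))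
    (hfm : ∀ κ u x z α ν, F κ u x z (Sum.inl α) (Sum.inr ν) = 0) (hm : ∀ κ u x z μ b, F κ u x z (Sum.inr μ) b = 0)
    (cΛ : ℝ) (ℓ k p : ℕ) (hp : p = ℓ + k + 1) (κ' : Fin (d + 1)) (u' x' z' : Fin (d + 1) → ℤ) (α β : Fin (d + 1)) :
    ((Lc : ℝ) ^ p) ^ (2 * (d + 1)) *
        e3OfS (Lc ^ p) (fun κ u => (((Lc : ℝ) ^ (d + 1)) ^ k * (cΛ * ((Lc : ℝ) ^ ℓ) ^ (2 * d + 4))) • F κ u) κ' u' x' z' (Sum.inl α) (Sum.inl β) =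
      -(cΛ / (Lc : ℝ) ^ (d + 1)) * ((Lc : ℝ) ^ p) ^ ((d : ℤ) - 2) * ((Lc : ℝ) ^ ℓ) ^ (d + 3) *
        ∑' y : Fin (d + 1) → ℤ, ∑ l' : Fin (d + 1),
          (∑' w : Fin (d + 1) → ℤ, ∑ l : Fin (d + 1), (((Lc : ℝ) ^ p) ^ (d + 2) * GamΦ (N := Lc ^ p) α x' l w) *
              ∑ κ'' : Fin (d + 1), (((Lc : ℝ) ^ p) ^ (d + 1))⁻¹ * ∑' u : Fin (d + 1) → ℤ,
                (((Lc : ℝ) ^ p) ^ (d + 2) * wH (N := Lc ^ p) κ'' κ' (u - ((Lc ^ p : ℕ) : ℤ) • u')) *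
                  F κ'' u w y (Sum.inl l) (Sum.inl l')) *
            (((Lc : ℝ) ^ p) ^ (d + 2) * wH (N := Lc ^ p) l' β (y - ((Lc ^ p : ℕ) : ℤ) • z')) := by
  subst hp
  rw [e3OfS_ff _ (fun κ u x z α' ν => by simp only [Pi.smul_apply, smul_eq_mul, hfm, mul_zero])
    (fun κ u x z μ b => by simp only [Pi.smul_apply, smul_eq_mul, hm, mul_zero])]
  simp only [Pi.smul_apply, smul_eq_mul]
  rw [pull_inner, pull_legs]
  have h := e3Lam_residual (Lc := Lc) (d := d) cΛ ℓ k
  have key : ∀ {N2 C D Z W a b c g T : ℝ}, N2 * C = D * Z * W * (a * b * c * 1 * g) →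
      N2 * -(C * T) = -D * Z * W * (a * b * c * g * T) := by
    intro N2 C D Z W a b c g T h
    calc N2 * -(C * T) = -(N2 * C) * T := by ring
      _ = -(D * Z * W * (a * b * c * 1 * g)) * T := by rw [h]
      _ = -D * Z * W * (a * b * c * g * T) := by ring
  exact key h

/-- [folklore] **THE (Λ) TEMPLATE, LEVEL `ℓ ≥ 1`** (pushed or top: the increment enters unchanged): `F = lagrInc d Lc (Lc^ℓ) (Lc^{ℓ+1})`. -/
theorem e3Lam_unit_split (cΛ : ℝ) (ℓ k p : ℕ) (hp : p = ℓ + k + 1) (κ' : Fin (d + 1)) (u' x' z' : Fin (d + 1) → ℤ) (α β : Fin (d + 1)) :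
    ((Lc : ℝ) ^ p) ^ (2 * (d + 1)) *
        e3OfS (Lc ^ p) (fun κ u => (((Lc : ℝ) ^ (d + 1)) ^ k * (cΛ * ((Lc : ℝ) ^ ℓ) ^ (2 * d + 4))) • lagrInc d Lc (Lc ^ ℓ) (Lc ^ (ℓ + 1)) κ u) κ' u' x' z' (Sum.inl α) (Sum.inl β) =
      -(cΛ / (Lc : ℝ) ^ (d + 1)) * ((Lc : ℝ) ^ p) ^ ((d : ℤ) - 2) * ((Lc : ℝ) ^ ℓ) ^ (d + 3) *
        ∑' y : Fin (d + 1) → ℤ, ∑ l' : Fin (d + 1),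
          (∑' w : Fin (d + 1) → ℤ, ∑ l : Fin (d + 1), (((Lc : ℝ) ^ p) ^ (d + 2) * GamΦ (N := Lc ^ p) α x' l w) *
              ∑ κ'' : Fin (d + 1), (((Lc : ℝ) ^ p) ^ (d + 1))⁻¹ * ∑' u : Fin (d + 1) → ℤ,
                (((Lc : ℝ) ^ p) ^ (d + 2) * wH (N := Lc ^ p) κ'' κ' (u - ((Lc ^ p : ℕ) : ℤ) • u')) *
                  lagrInc d Lc (Lc ^ ℓ) (Lc ^ (ℓ + 1)) κ'' u w y (Sum.inl l) (Sum.inl l')) *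
            (((Lc : ℝ) ^ p) ^ (d + 2) * wH (N := Lc ^ p) l' β (y - ((Lc ^ p : ℕ) : ℤ) • z')) :=
  e3FF_unit_split_of (Lc := Lc) (fun κ u => lagrInc d Lc (Lc ^ ℓ) (Lc ^ (ℓ + 1)) κ u) (fun κ u x z α ν => lagrInc_inl_inr κ u x z α ν)
    (fun κ u x z μ b => lagrInc_inr κ u x z μ b) cΛ ℓ k p hp κ' u' x' z' α β

/-- [folklore] **THE (Λ) TEMPLATE, TOP LEVEL** (`k = 0`: the unpushed top Lagrange increment of `Sc_succ_closed`, natural weight `cΛ·M^{2d+4}`,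
member `p = ℓ+1`). -/
theorem e3LamTop_unit_split (cΛ : ℝ) (ℓ p : ℕ) (hp : p = ℓ + 1) (κ' : Fin (d + 1)) (u' x' z' : Fin (d + 1) → ℤ) (α β : Fin (d + 1)) :
    ((Lc : ℝ) ^ p) ^ (2 * (d + 1)) *
        e3OfS (Lc ^ p) (fun κ u => (cΛ * ((Lc : ℝ) ^ ℓ) ^ (2 * d + 4)) • lagrInc d Lc (Lc ^ ℓ) (Lc ^ (ℓ + 1)) κ u) κ' u' x' z' (Sum.inl α) (Sum.inl β) =
      -(cΛ / (Lc : ℝ) ^ (d + 1)) * ((Lc : ℝ) ^ p) ^ ((d : ℤ) - 2) * ((Lc : ℝ) ^ ℓ) ^ (d + 3) *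
        ∑' y : Fin (d + 1) → ℤ, ∑ l' : Fin (d + 1),
          (∑' w : Fin (d + 1) → ℤ, ∑ l : Fin (d + 1), (((Lc : ℝ) ^ p) ^ (d + 2) * GamΦ (N := Lc ^ p) α x' l w) *
              ∑ κ'' : Fin (d + 1), (((Lc : ℝ) ^ p) ^ (d + 1))⁻¹ * ∑' u : Fin (d + 1) → ℤ,
                (((Lc : ℝ) ^ p) ^ (d + 2) * wH (N := Lc ^ p) κ'' κ' (u - ((Lc ^ p : ℕ) : ℤ) • u')) *
                  lagrInc d Lc (Lc ^ ℓ) (Lc ^ (ℓ + 1)) κ'' u w y (Sum.inl l) (Sum.inl l')) *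
            (((Lc : ℝ) ^ p) ^ (d + 2) * wH (N := Lc ^ p) l' β (y - ((Lc ^ p : ℕ) : ℤ) • z')) := by
  simpa only [pow_zero, one_mul] using e3Lam_unit_split (Lc := Lc) (d := d) cΛ ℓ 0 p (by simpa using hp) κ' u' x' z' α β

/-- [folklore] **THE (Λ) TEMPLATE, LEVEL `0`** (`S₀`'s Lagrange stencil, natural weight `(Lc^{d+1})^k·cΛ`, member `p = k+1`; `M^{d+3} = 1`). -/
theorem e3Lam0_unit_split (cΛ : ℝ) (k p : ℕ) (hp : p = k + 1) (κ' : Fin (d + 1)) (u' x' z' : Fin (d + 1) → ℤ) (α β : Fin (d + 1)) :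
    ((Lc : ℝ) ^ p) ^ (2 * (d + 1)) *
        e3OfS (Lc ^ p) (fun κ u => (((Lc : ℝ) ^ (d + 1)) ^ k * cΛ) • SLam Lc (lamCoeffOf (KInv (N := Lc) (d := d)) Lc) (fun μ y => hessFF Lc μ y) κ u) κ' u' x' z' (Sum.inl α) (Sum.inl β) =
      -(cΛ / (Lc : ℝ) ^ (d + 1)) * ((Lc : ℝ) ^ p) ^ ((d : ℤ) - 2) *
        ∑' y : Fin (d + 1) → ℤ, ∑ l' : Fin (d + 1),
          (∑' w : Fin (d + 1) → ℤ, ∑ l : Fin (d + 1), (((Lc : ℝ) ^ p) ^ (d + 2) * GamΦ (N := Lc ^ p) α x' l w) *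
              ∑ κ'' : Fin (d + 1), (((Lc : ℝ) ^ p) ^ (d + 1))⁻¹ * ∑' u : Fin (d + 1) → ℤ,
                (((Lc : ℝ) ^ p) ^ (d + 2) * wH (N := Lc ^ p) κ'' κ' (u - ((Lc ^ p : ℕ) : ℤ) • u')) *
                  SLam Lc (lamCoeffOf (KInv (N := Lc) (d := d)) Lc) (fun μ y => hessFF Lc μ y) κ'' u w y (Sum.inl l) (Sum.inl l')) *
            (((Lc : ℝ) ^ p) ^ (d + 2) * wH (N := Lc ^ p) l' β (y - ((Lc ^ p : ℕ) : ℤ) • z')) := by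
  simpa only [pow_zero, one_pow, mul_one] using
    e3FF_unit_split_of (Lc := Lc) (fun κ u => SLam Lc (lamCoeffOf (KInv (N := Lc) (d := d)) Lc) (fun μ y => hessFF Lc μ y) κ u)
      (fun κ u x z α ν => SLam0_inl_inr κ u x z α ν) (fun κ u x z μ b => SLam0_inr κ u x z μ b) cΛ 0 k p (by simpa using hp)
      κ' u' x' z' α β

/-- [folklore] **EXPONENT IDENTITY, (V-H) CHANNEL, LEVEL `ℓ`**: `N^{2(d+1)}·(Lc^{d+1})^k·cVH·M^{d+2} = (cVH/Lc^{d+1})·N^{−2}·M·[N^{2(d+1)}·N^{−(d+1)}·N^{d+2}·N^{d+2}]`. -/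
theorem e3VH_residual (cVH : ℝ) (ℓ k : ℕ) :
    ((Lc : ℝ) ^ (ℓ + k + 1)) ^ (2 * (d + 1)) * (((Lc : ℝ) ^ (d + 1)) ^ k * (cVH * ((Lc : ℝ) ^ ℓ) ^ (d + 2))) =
      cVH / (Lc : ℝ) ^ (d + 1) * ((Lc : ℝ) ^ (ℓ + k + 1)) ^ (-(2 : ℤ)) * (Lc : ℝ) ^ ℓ *
        (((Lc : ℝ) ^ (ℓ + k + 1)) ^ (2 * (d + 1)) * (((Lc : ℝ) ^ (ℓ + k + 1)) ^ (d + 1))⁻¹ * ((Lc : ℝ) ^ (ℓ + k + 1)) ^ (d + 2) *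
          ((Lc : ℝ) ^ (ℓ + k + 1)) ^ (d + 2)) := by
  have hL : (Lc : ℝ) ≠ 0 := by exact_mod_cast NeZero.ne Lc
  have hN : ((Lc : ℝ) ^ (ℓ + k + 1)) ≠ 0 := pow_ne_zero _ hL
  rw [zpow_neg, zpow_ofNat]
  field_simp
  ring

/-- [folklore] **`e3VH_unit_split_of` — THE (V-H) TEMPLATE** for ANY off-diagonal family `P` with the level-`ℓ` border weight pushed `k` times
(member `p = ℓ+k+1`; `Φ̃_N := N^{2(d+1)}·(KInv_N)_{mm}`, `G̃_N`, `H̃_N` with block average):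
`N^{2(d+1)}·e3OfS N ((Lc^{d+1})^k·cVH·M^{d+2} • P) = −(cVH/Lc^{d+1})·N^{−2}·M·[two-channel unit sandwich of P]` — residual `N^{−2}·M` DISPLAYED. -/
theorem e3VH_unit_split_of (P : Fin (d + 1) → (Fin (d + 1) → ℤ) → MKer (d + 1) (Fib d))
    (hff : ∀ κ u x z α β, P κ u x z (Sum.inl α) (Sum.inl β) = 0) (hmm : ∀ κ u x z μ ν, P κ u x z (Sum.inr μ) (Sum.inr ν) = 0)
    (cVH : ℝ) (ℓ k p : ℕ) (hp : p = ℓ + k + 1) (κ' : Fin (d + 1)) (u' x' z' : Fin (d + 1) → ℤ) (α β : Fin (d + 1)) :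
    ((Lc : ℝ) ^ p) ^ (2 * (d + 1)) *
        e3OfS (Lc ^ p) (fun κ u => (((Lc : ℝ) ^ (d + 1)) ^ k * (cVH * ((Lc : ℝ) ^ ℓ) ^ (d + 2))) • P κ u) κ' u' x' z' (Sum.inl α) (Sum.inl β) =
      -(cVH / (Lc : ℝ) ^ (d + 1)) * ((Lc : ℝ) ^ p) ^ (-(2 : ℤ)) * (Lc : ℝ) ^ ℓ *
        ∑' y : Fin (d + 1) → ℤ,
          ((∑ l' : Fin (d + 1),
            (∑' w : Fin (d + 1) → ℤ, ∑ l : Fin (d + 1),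
                (((Lc : ℝ) ^ p) ^ (2 * (d + 1)) * KInv (N := Lc ^ p) (d := d) (((Lc ^ p : ℕ) : ℤ) • x') w (Sum.inr α) (Sum.inr l)) *
                ∑ κ'' : Fin (d + 1), (((Lc : ℝ) ^ p) ^ (d + 1))⁻¹ * ∑' u : Fin (d + 1) → ℤ,
                  (((Lc : ℝ) ^ p) ^ (d + 2) * wH (N := Lc ^ p) κ'' κ' (u - ((Lc ^ p : ℕ) : ℤ) • u')) *
                    P κ'' u w y (Sum.inr l) (Sum.inl l')) *
              (((Lc : ℝ) ^ p) ^ (d + 2) * wH (N := Lc ^ p) l' β (y - ((Lc ^ p : ℕ) : ℤ) • z'))) +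
          ∑ l' : Fin (d + 1),
            (∑' w : Fin (d + 1) → ℤ, ∑ l : Fin (d + 1),
                (((Lc : ℝ) ^ p) ^ (d + 2) * GamΦ (N := Lc ^ p) α x' l w) *
                ∑ κ'' : Fin (d + 1), (((Lc : ℝ) ^ p) ^ (d + 1))⁻¹ * ∑' u : Fin (d + 1) → ℤ,
                  (((Lc : ℝ) ^ p) ^ (d + 2) * wH (N := Lc ^ p) κ'' κ' (u - ((Lc ^ p : ℕ) : ℤ) • u')) *
                    P κ'' u w y (Sum.inl l) (Sum.inr l')) *
              (((Lc : ℝ) ^ p) ^ (2 * (d + 1)) *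
                KInv (N := Lc ^ p) (d := d) y (((Lc ^ p : ℕ) : ℤ) • z') (Sum.inr l') (Sum.inr β))) := by
  subst hp
  rw [e3OfS_offdiag _ (fun κ u x z α' β' => by simp only [Pi.smul_apply, smul_eq_mul, hff, mul_zero])
    (fun κ u x z μ ν => by simp only [Pi.smul_apply, smul_eq_mul, hmm, mul_zero])]
  simp only [Pi.smul_apply, smul_eq_mul]
  rw [pull_two_inner, pull_two_legs _ _ _ _ _ _ _ _ _ _ _ _ _ (by ring)]
  have h := e3VH_residual (Lc := Lc) (d := d) cVH ℓ k
  have key : ∀ {N2 C D Z W a b c g T : ℝ}, N2 * C = D * Z * W * (a * b * c * g) →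
      N2 * -(C * T) = -D * Z * W * (a * b * c * g * T) := by
    intro N2 C D Z W a b c g T h
    calc N2 * -(C * T) = -(N2 * C) * T := by ring
      _ = -(D * Z * W * (a * b * c * g)) * T := by rw [h]
      _ = -D * Z * W * (a * b * c * g * T) := by ring
  exact key h

omit [NeZero Lc] in
/-- [folklore] A pushed border increment is off-diagonal (ff). -/
theorem pushSum_borderInc_inl_inl {M L M' : ℕ} (κ : Fin (d + 1)) (u x z : Fin (d + 1) → ℤ) (α β : Fin (d + 1)) :
    pushSum M L (borderInc d Lc M' κ u) x z (Sum.inl α) (Sum.inl β) = 0 := by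
  rw [pushSum_inl_inl, borderInc_inl_inl]

omit [NeZero Lc] in
/-- [folklore] A pushed border increment is off-diagonal (mm). -/
theorem pushSum_borderInc_inr_inr {M L M' : ℕ} (κ : Fin (d + 1)) (u x z : Fin (d + 1) → ℤ) (μ ν : Fin (d + 1)) :
    pushSum M L (borderInc d Lc M' κ u) x z (Sum.inr μ) (Sum.inr ν) = 0 :=
  pushSum_block_zero _ _ _ (fun x z => borderInc_inr_inr κ u x z μ ν) x z

/-- [folklore] **THE (V-H) TEMPLATE, LEVEL `ℓ ≥ 1`, PUSHED `k` TIMES**: `P = pushSum (Lc^{ℓ+1}) (Lc^k) (borderInc d Lc (Lc^ℓ) κ u)`. -/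
theorem e3VH_unit_split (cVH : ℝ) (ℓ k p : ℕ) (hp : p = ℓ + k + 1) (κ' : Fin (d + 1)) (u' x' z' : Fin (d + 1) → ℤ) (α β : Fin (d + 1)) :
    ((Lc : ℝ) ^ p) ^ (2 * (d + 1)) *
        e3OfS (Lc ^ p) (fun κ u => (((Lc : ℝ) ^ (d + 1)) ^ k * (cVH * ((Lc : ℝ) ^ ℓ) ^ (d + 2))) • pushSum (Lc ^ (ℓ + 1)) (Lc ^ k) (borderInc d Lc (Lc ^ ℓ) κ u)) κ' u' x' z' (Sum.inl α) (Sum.inl β) =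
      -(cVH / (Lc : ℝ) ^ (d + 1)) * ((Lc : ℝ) ^ p) ^ (-(2 : ℤ)) * (Lc : ℝ) ^ ℓ *
        ∑' y : Fin (d + 1) → ℤ,
          ((∑ l' : Fin (d + 1),
            (∑' w : Fin (d + 1) → ℤ, ∑ l : Fin (d + 1),
                (((Lc : ℝ) ^ p) ^ (2 * (d + 1)) * KInv (N := Lc ^ p) (d := d) (((Lc ^ p : ℕ) : ℤ) • x') w (Sum.inr α) (Sum.inr l)) *
                ∑ κ'' : Fin (d + 1), (((Lc : ℝ) ^ p) ^ (d + 1))⁻¹ * ∑' u : Fin (d + 1) → ℤ,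
                  (((Lc : ℝ) ^ p) ^ (d + 2) * wH (N := Lc ^ p) κ'' κ' (u - ((Lc ^ p : ℕ) : ℤ) • u')) *
                    pushSum (Lc ^ (ℓ + 1)) (Lc ^ k) (borderInc d Lc (Lc ^ ℓ) κ'' u) w y (Sum.inr l) (Sum.inl l')) *
              (((Lc : ℝ) ^ p) ^ (d + 2) * wH (N := Lc ^ p) l' β (y - ((Lc ^ p : ℕ) : ℤ) • z'))) +
          ∑ l' : Fin (d + 1),
            (∑' w : Fin (d + 1) → ℤ, ∑ l : Fin (d + 1),
                (((Lc : ℝ) ^ p) ^ (d + 2) * GamΦ (N := Lc ^ p) α x' l w) *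
                ∑ κ'' : Fin (d + 1), (((Lc : ℝ) ^ p) ^ (d + 1))⁻¹ * ∑' u : Fin (d + 1) → ℤ,
                  (((Lc : ℝ) ^ p) ^ (d + 2) * wH (N := Lc ^ p) κ'' κ' (u - ((Lc ^ p : ℕ) : ℤ) • u')) *
                    pushSum (Lc ^ (ℓ + 1)) (Lc ^ k) (borderInc d Lc (Lc ^ ℓ) κ'' u) w y (Sum.inl l) (Sum.inr l')) *
              (((Lc : ℝ) ^ p) ^ (2 * (d + 1)) *
                KInv (N := Lc ^ p) (d := d) y (((Lc ^ p : ℕ) : ℤ) • z') (Sum.inr l') (Sum.inr β))) :=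
  e3VH_unit_split_of (Lc := Lc) (fun κ u => pushSum (Lc ^ (ℓ + 1)) (Lc ^ k) (borderInc d Lc (Lc ^ ℓ) κ u))
    (fun κ u x z α β => pushSum_borderInc_inl_inl κ u x z α β) (fun κ u x z μ ν => pushSum_borderInc_inr_inr κ u x z μ ν)
    cVH ℓ k p hp κ' u' x' z' α β

/-- [folklore] **THE (V-H) TEMPLATE, TOP LEVEL** (`k = 0`: the unpushed top border increment, natural weight `cVH·M^{d+2}`, member `p = ℓ+1`). -/
theorem e3VHTop_unit_split (cVH : ℝ) (ℓ p : ℕ) (hp : p = ℓ + 1) (κ' : Fin (d + 1)) (u' x' z' : Fin (d + 1) → ℤ) (α β : Fin (d + 1)) :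
    ((Lc : ℝ) ^ p) ^ (2 * (d + 1)) *
        e3OfS (Lc ^ p) (fun κ u => (cVH * ((Lc : ℝ) ^ ℓ) ^ (d + 2)) • borderInc d Lc (Lc ^ ℓ) κ u) κ' u' x' z' (Sum.inl α) (Sum.inl β) =
      -(cVH / (Lc : ℝ) ^ (d + 1)) * ((Lc : ℝ) ^ p) ^ (-(2 : ℤ)) * (Lc : ℝ) ^ ℓ *
        ∑' y : Fin (d + 1) → ℤ,
          ((∑ l' : Fin (d + 1),
            (∑' w : Fin (d + 1) → ℤ, ∑ l : Fin (d + 1),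
                (((Lc : ℝ) ^ p) ^ (2 * (d + 1)) * KInv (N := Lc ^ p) (d := d) (((Lc ^ p : ℕ) : ℤ) • x') w (Sum.inr α) (Sum.inr l)) *
                ∑ κ'' : Fin (d + 1), (((Lc : ℝ) ^ p) ^ (d + 1))⁻¹ * ∑' u : Fin (d + 1) → ℤ,
                  (((Lc : ℝ) ^ p) ^ (d + 2) * wH (N := Lc ^ p) κ'' κ' (u - ((Lc ^ p : ℕ) : ℤ) • u')) *
                    borderInc d Lc (Lc ^ ℓ) κ'' u w y (Sum.inr l) (Sum.inl l')) *
              (((Lc : ℝ) ^ p) ^ (d + 2) * wH (N := Lc ^ p) l' β (y - ((Lc ^ p : ℕ) : ℤ) • z'))) +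
          ∑ l' : Fin (d + 1),
            (∑' w : Fin (d + 1) → ℤ, ∑ l : Fin (d + 1),
                (((Lc : ℝ) ^ p) ^ (d + 2) * GamΦ (N := Lc ^ p) α x' l w) *
                ∑ κ'' : Fin (d + 1), (((Lc : ℝ) ^ p) ^ (d + 1))⁻¹ * ∑' u : Fin (d + 1) → ℤ,
                  (((Lc : ℝ) ^ p) ^ (d + 2) * wH (N := Lc ^ p) κ'' κ' (u - ((Lc ^ p : ℕ) : ℤ) • u')) *
                    borderInc d Lc (Lc ^ ℓ) κ'' u w y (Sum.inl l) (Sum.inr l')) *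
              (((Lc : ℝ) ^ p) ^ (2 * (d + 1)) *
                KInv (N := Lc ^ p) (d := d) y (((Lc ^ p : ℕ) : ℤ) • z') (Sum.inr l') (Sum.inr β))) := by
  simpa only [pow_zero, one_mul] using
    e3VH_unit_split_of (Lc := Lc) (fun κ u => borderInc d Lc (Lc ^ ℓ) κ u) (fun κ u x z α β => borderInc_inl_inl κ u x z α β)
      (fun κ u x z μ ν => borderInc_inr_inr κ u x z μ ν) cVH ℓ 0 p (by simpa using hp) κ' u' x' z' α β

end Levels

end Summit.QuantumFields.BalabanUV.Beta.GAN24.E3UnitSplit
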